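import Literature.AlgebraicGeometry.ModuliOfAbelianVarieties.SiegelFineModuliSchemeLevelGroupQuotientUniversal
import Literature.AlgebraicGeometry.ModuliOfAbelianVarieties.SiegelFineModuliSchemeLevelQuotientClauses
import Literature.AlgebraicGeometry.ModuliOfAbelianVarieties.SiegelFineModuliSchemeLevelQuotientClassify
import Literature.AlgebraicGeometry.ModuliOfAbelianVarieties.SiegelFineModuliSchemeExists
import HarnessLib

/-!
# Level descent for fine Siegel moduli schemes: `A_{g,δ,N₀} = A_{g,δ,N₀d}/Γ` with the clauses of (F)
# ([MumfordFogartyKirwan1994] Ch. 7 §3, Thm. 7.9 and the remark following it, Lemma 7.11; [Lan2013PELCompactifications] Cor. 1.4.1.12)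

Topic `AlgebraicGeometry/ModuliOfAbelianVarieties`; namespace `Literature.AlgebraicGeometry.ModuliOfAbelianVarieties`.
THEOREMS ONLY (no definition, no named fact, no instance, no notation, no `sorry`; net Literature debt 0 — the new carrier is a
structure literal inside `∃`).  Cell `hodgecm-mathlib` (D-0151), F-DAG node F-10 «LEVEL DESCENT `N ≫ 0 ⇒ N ≥ 3`», brick
**(pack)** = the ASSEMBLY of the F-10 (b) tail (book B-plan1 (g16) 07:43:13Z / 07:52:56Z; author B-p02 (g13)).  Count-neutral
capital; HC_CM is proved only modulo the 7 printed citations until rung 0 closes — nothing here is about HC.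

[MumfordFogartyKirwan1994] Ch. 7 §3 p. 139, after Thm. 7.9 («`A_{g,d,n}` exists, quasi-projective, for `n` large»): «using the
so-called "lemma of Serre" …, it can be shown that Theorem 7.9 is true even if `n ≥ 3`» — `A_{g,d,n} := A_{g,d,nk}/Γ_n^{(k)}`,
Lemma 7.11 (p. 140): `A_{g,d,nk} → A_{g,d,n}` is a finite étale Galois covering; [Lan2013PELCompactifications] Cor. 1.4.1.12
(p. 91) / Rem. 1.4.1.9 (p. 90).  In the tree's currency ((F) = ★ `lan2013_siegelFineModuliScheme`: `∃ 𝓜 : SiegelFineModuliScheme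
g N δ` with `Smooth 𝓜.M.hom`, `IsQuasiProjectiveOver 𝓜.M`, `IsQuasiProjectiveOver (total space of 𝓜.univ.A)`):

* **`SiegelFineModuliScheme.exists_levelDescent`** — from a fine moduli carrier `𝓜` of level `N = N₀ d`, `N₀ ≥ 3`, with the
  three (F) clauses, a fine moduli carrier `𝓠 : SiegelFineModuliScheme g N₀ δ` WITH THE THREE (F) CLAUSES (and the dual's
  total space quasi-projective too), together with a finite étale surjective `ℚ`-morphism `q : M → 𝓠.M` killed by the twist
  operators of `K_δ(N₀)`, universal among such morphisms to separated `ℚ`-schemes, along which `𝒰.changeLevel N₀` is the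
  pull-back of `𝓠.univ`.  ASSEMBLY, all inputs ★ by name: the quotient `M → Q = M/Δ` with the descended universal triple
  `X_Q` (★ `exists_univ_desc_levelGroupQuotient`: (Q) ★ `exists_levelGroupQuotient_action` + (Q-free) + (O-A) + (10a)),
  `Smooth Q.hom` ((10c) ★ `smooth_levelGroupQuotient_hom`), and the `classify` field VERBATIM = ★
  `existsUnique_hom_isBaseChangeVia_levelQuotient` ((b2′) existence + relation, (b3) uniqueness); the carrier is the structure
  literal `⟨Q, _, X_Q, classify⟩`.
* **`lan2013_siegelFineModuliScheme_of_large_levels`** — «fine moduli carriers with the (F) clauses exist at every level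
  `N ≥ β(g, δ)` (and `≥ 3`) ⇒ (F)»: for `N ≥ 3` take `d := β g δ + 1`, a carrier at level `N d ≥ β g δ`, and descend.  This is
  the F-10 node of the F-12 assembly: (F) = F-8/F-9/F-11 AT LARGE LEVEL + this theorem.

## References
* [MumfordFogartyKirwan1994] D. Mumford, J. Fogarty, F. Kirwan, *Geometric Invariant Theory*, 3rd ed. (1994), Ch. 7 §3:
  Theorem 7.9 and the remark following it (p. 139), Lemma 7.11 (p. 140).
* [Lan2013PELCompactifications] K.-W. Lan, *Arithmetic compactifications of PEL-type Shimura varieties* (2013), §1.4.1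
  Remark 1.4.1.9 (p. 90), Cor. 1.4.1.12 (p. 91).
* [Deligne1971TravauxShimura] P. Deligne, *Travaux de Shimura* (1971), 4.16 p. 150.
-/

noncomputable section

open CategoryTheory CategoryTheory.Limits AlgebraicGeometry

namespace Literature.AlgebraicGeometry.ModuliOfAbelianVarieties

open Literature.AlgebraicGeometry.Motives Literature.AlgebraicGeometry.HodgeTheory
open Literature.AlgebraicGeometry.AbelianSchemes (PolarizedAbelianSchemeWithLevel)
open Literature.AlgebraicGeometry.AbelianSchemes.AbelianSchemeOver Literature.AlgebraicGeometry.RelativeSpec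
open Literature.NumberTheory.Adeles NumberField IsDedekindDomain
open scoped Matrix

namespace SiegelFineModuliScheme

variable {g N : ℕ} {δ : Fin g → ℕ} (𝓜 : SiegelFineModuliScheme g N δ) [IsCommMonObj 𝓜.univ.A.X] [NeZero N]

/-- **LEVEL DESCENT `A_{g,δ,N₀} = A_{g,δ,N₀d}/Γ` WITH THE CLAUSES OF (F)** ([MumfordFogartyKirwan1994] Ch. 7 §3, Thm. 7.9 and
the remark following it (p. 139), Lemma 7.11 (p. 140); [Lan2013PELCompactifications] Cor. 1.4.1.12).  Let `𝓜` be a fine moduli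
carrier of level `N = N₀ d` with `3 ≤ N₀`, smooth and quasi-projective over `ℚ` with quasi-projective universal total space
(the three clauses of (F) ★ `lan2013_siegelFineModuliScheme`).  THEN there is a fine moduli carrier
`𝓠 : SiegelFineModuliScheme g N₀ δ` with the same three clauses (and the total space of the dual `𝓠.univ.D.hat`
quasi-projective as well), a finite étale surjective `ℚ`-morphism `q : M → 𝓠.M` with `T_Γ̄ ≫ q = q` for every twist operator
of `K_δ(N₀)`, universal among such `ℚ`-morphisms to separated targets (so `𝓠.M = M/Δ` categorically), and comparison maps
exhibiting `𝒰.changeLevel N₀` as the pull-back of `𝓠.univ` along `q`.  Assembly of ★ `exists_univ_desc_levelGroupQuotient`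
(quotient + descended triple), ★ `smooth_levelGroupQuotient_hom` (smoothness descends along the finite étale `q`) and ★
`existsUnique_hom_isBaseChangeVia_levelQuotient` (the `classify` field); reducedness of `M` by ★
`isReduced_of_smooth_over_field`.  (The instance binder `[IsCommMonObj 𝒰.A.X]` is only needed to STATE the twist clauses; it
always holds, ★ `isCommMonObj_of_isLocallyNoetherian_base`.)
[cite: MumfordFogartyKirwan1994, Ch. 7 §3 Theorem 7.9 and the remark following it (p. 139)]
[cite: MumfordFogartyKirwan1994, Ch. 7 §3, remark after Thm. 7.9 and Lemma 7.11 (pp. 139–140)]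
[cite: Lan2013PELCompactifications, §1.4.1 Remark 1.4.1.9 (p. 90)] -/
theorem exists_levelDescent (hg : 0 < g) (hδ : IsPolarizationType δ) {N₀ d : ℕ} [NeZero N₀] (hd : N = N₀ * d)
    (hN₀ : 3 ≤ N₀) (hsm : Smooth 𝓜.M.hom) (hqp : IsQuasiProjectiveOver 𝓜.M)
    (hqpA : IsQuasiProjectiveOver (Over.mk (𝓜.univ.A.X.hom ≫ 𝓜.M.hom) : SchemeOver ℚ)) :
    ∃ 𝓠 : SiegelFineModuliScheme g N₀ δ, Smooth 𝓠.M.hom ∧ IsQuasiProjectiveOver 𝓠.M ∧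
      IsQuasiProjectiveOver (Over.mk (𝓠.univ.A.X.hom ≫ 𝓠.M.hom) : SchemeOver ℚ) ∧
      IsQuasiProjectiveOver (Over.mk (𝓠.univ.D.hat.X.hom ≫ 𝓠.M.hom) : SchemeOver ℚ) ∧
      ∃ (q : 𝓜.M ⟶ 𝓠.M) (ϖ : 𝓜.univ.A.X.left ⟶ 𝓠.univ.A.X.left)
        (ϖh : 𝓜.univ.D.hat.X.left ⟶ 𝓠.univ.D.hat.X.left),
        IsFinite q.left ∧ Etale q.left ∧ Surjective q.left ∧
        (∀ (r : gspFinAdelic δ) (_ : r ∈ principalLevelSubgroup δ N₀) (GN : GL (Fin g ⊕ Fin g) (ZMod N))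
          (_ : ∀ (i j : Fin g ⊕ Fin g)
            (h : ((r : GL (Fin g ⊕ Fin g) finAdeleQ) : Matrix (Fin g ⊕ Fin g) (Fin g ⊕ Fin g) finAdeleQ) i j ∈
              FiniteAdeleRing.integralAdeles (𝓞 ℚ) ℚ),
            (GN : Matrix (Fin g ⊕ Fin g) (Fin g ⊕ Fin g) (ZMod N)) i j = integralAdeleResidue N ⟨_, h⟩)
          (hs : (𝓜.univ.level.twist GN).IsSymplecticLiftable 𝓜.univ.pol δ),
          (haveI := 𝓜.isLocallyNoetherian
           (𝓜.classifyingMap 𝓜.M ({ 𝓜.univ with level := 𝓜.univ.level.twist GN, symplectic := hs } :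
             PolarizedAbelianSchemeWithLevel g N δ 𝓜.M.left)).left) ≫ q.left = q.left) ∧
        (∀ (Z : SchemeOver ℚ) [Z.left.IsSeparated] (h : 𝓜.M ⟶ Z),
          (∀ (r : gspFinAdelic δ) (_ : r ∈ principalLevelSubgroup δ N₀) (GN : GL (Fin g ⊕ Fin g) (ZMod N))
            (_ : ∀ (i j : Fin g ⊕ Fin g)
              (h : ((r : GL (Fin g ⊕ Fin g) finAdeleQ) : Matrix (Fin g ⊕ Fin g) (Fin g ⊕ Fin g) finAdeleQ) i j ∈
                FiniteAdeleRing.integralAdeles (𝓞 ℚ) ℚ),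
              (GN : Matrix (Fin g ⊕ Fin g) (Fin g ⊕ Fin g) (ZMod N)) i j = integralAdeleResidue N ⟨_, h⟩)
            (hs : (𝓜.univ.level.twist GN).IsSymplecticLiftable 𝓜.univ.pol δ),
            (haveI := 𝓜.isLocallyNoetherian
             𝓜.classifyingMap 𝓜.M ({ 𝓜.univ with level := 𝓜.univ.level.twist GN, symplectic := hs } :
               PolarizedAbelianSchemeWithLevel g N δ 𝓜.M.left)) ≫ h = h) →
          ∃! hQ : 𝓠.M ⟶ Z, q ≫ hQ = h) ∧
        (𝓜.univ.changeLevel N₀ d hd (NeZero.ne N)).IsBaseChangeVia 𝓠.univ q.left ϖ ϖh := by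
  haveI := 𝓜.isLocallyNoetherian
  haveI : Smooth 𝓜.M.hom := hsm
  haveI : IsReduced 𝓜.M.left := isReduced_of_smooth_over_field 𝓜.M.hom
  haveI : LocallyOfFiniteType 𝓜.M.hom := hqp.hom_locallyOfFiniteType
  -- the quotient `q : M → Q = M/Δ`, its action datum and the descended universal triple `X`
  obtain ⟨red, Δ, act, Q, q, ρ, X, ϖ, ϖh, hred, -, hΔsurj, hop, hρ, hq, hfin, -, hlft, hqpQ, hp, huniv, het, hsurj,
    hnoeth, hX, hqpX, hqpXh⟩ := 𝓜.exists_univ_desc_levelGroupQuotient hδ hg hd hN₀ hqp hqpA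
  haveI := hfin
  haveI := hlft
  haveI := het
  haveI := hsurj
  -- smoothness descends along the finite étale surjection `q` ((10c))
  have hsmQ : Smooth Q.hom := 𝓜.smooth_levelGroupQuotient_hom hδ hg hd hN₀ red Δ act hred hΔsurj hop q ρ hρ hq hsm
  -- the carrier: `classify` is (b2′) + (b3) verbatim
  exact ⟨⟨Q, hnoeth, X, fun T _ Y => 𝓜.existsUnique_hom_isBaseChangeVia_levelQuotient hδ hg hd hN₀ q hp X hX Y⟩,
    hsmQ, hqpQ, hqpX, hqpXh, q, ϖ, ϖh, hfin, het, hsurj, hp, huniv, hX⟩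

end SiegelFineModuliScheme

/-- **FINE MODULI SCHEMES AT ALL LARGE LEVELS ⇒ (F)** ([MumfordFogartyKirwan1994] Ch. 7 §3, Thm. 7.9 «for `n` large» and the
remark following it «true even if `n ≥ 3`», p. 139; [Lan2013PELCompactifications] Cor. 1.4.1.12).  If for every `g > 0`,
polarisation type `δ` and every level `N ≥ 3` with `β g δ ≤ N` there is a fine moduli carrier of level `N` with the three
clauses of (F), then (F) ★ `lan2013_siegelFineModuliScheme` holds (every level `N ≥ 3`): raise the level to `N (β g δ + 1)` and
descend by `SiegelFineModuliScheme.exists_levelDescent`.  The F-10 node of the F-12 assembly.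
[cite: MumfordFogartyKirwan1994, Ch. 7 §3 Theorem 7.9 and the remark following it (p. 139)]
[cite: Lan2013PELCompactifications, §1.4.1 Remark 1.4.1.9 (p. 90)] -/
theorem lan2013_siegelFineModuliScheme_of_large_levels (β : (g : ℕ) → (Fin g → ℕ) → ℕ)
    (h : ∀ (g N : ℕ) (δ : Fin g → ℕ), 0 < g → IsPolarizationType δ → 3 ≤ N → β g δ ≤ N →
      ∃ 𝓜 : SiegelFineModuliScheme g N δ, Smooth 𝓜.M.hom ∧ IsQuasiProjectiveOver 𝓜.M ∧
        IsQuasiProjectiveOver (Over.mk (𝓜.univ.A.X.hom ≫ 𝓜.M.hom) : SchemeOver ℚ)) :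
    lan2013_siegelFineModuliScheme := by
  intro g N δ hg hδ hN
  -- raise the level to `N * d ≥ β g δ`, then descend
  obtain ⟨d, hd, hle⟩ : ∃ d : ℕ, d ≠ 0 ∧ β g δ ≤ N * d :=
    ⟨β g δ + 1, Nat.succ_ne_zero _, (Nat.le_succ _).trans (Nat.le_mul_of_pos_left _ (by omega))⟩
  have hN0 : N ≠ 0 := by omega
  haveI : NeZero N := ⟨hN0⟩
  haveI : NeZero (N * d) := ⟨Nat.mul_ne_zero hN0 hd⟩
  have h3 : 3 ≤ N * d := hN.trans (Nat.le_mul_of_pos_right N (Nat.pos_of_ne_zero hd))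
  obtain ⟨𝓜, hsm, hqp, hqpA⟩ := h g (N * d) δ hg hδ h3 hle
  haveI := 𝓜.isLocallyNoetherian
  haveI : IsCommMonObj 𝓜.univ.A.X := 𝓜.univ.A.isCommMonObj_of_isLocallyNoetherian_base
  obtain ⟨𝓠, hs, hq, hqA, -⟩ := 𝓜.exists_levelDescent hg hδ rfl hN hsm hqp hqpA
  exact ⟨𝓠, hs, hq, hqA⟩

end Literature.AlgebraicGeometry.ModuliOfAbelianVarieties

end
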